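import Summits.BirchSwinnertonDyer.Rank1Residual.X11b.RouteR1IntReceptacle
import Mathlib.RingTheory.AdjoinRoot
import Mathlib.Algebra.Polynomial.SpecificDegree
import Mathlib.RingTheory.DiscreteValuationRing.Basic
import Mathlib.NumberTheory.Padics.RingHoms
import Literature.NumberTheory.LocalFields.PadicApproximateSolutions
import HarnessLib

set_option linter.dupNamespace false -- `Summit.BirchSwinnertonDyer.BirchSwinnertonDyer.Theorems.…` (summit = sub)
set_option autoImplicit false

/-!
# Crux `EisensteinHeartFlatCMInertBadKPrime` (stmt-BirchSwinnertonDyer-21341), line `hsieh-lambda`, layer 2 (V3), part 10: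
# the coefficient ring `𝒪 = ℤ_p[√d] = ℤ_p[X]/(X² − d)` for `d` a NON-SQUARE UNIT mod `p` — a DVR, free of rank `2` over `ℤ_p` with
# basis `(1, √d)`, `√d ∈ 𝒪ˣ`, embedding into `𝓞_{ℂ_p}` — i.e. the socket `𝒪` of `…ShapiroDatum` (V3) is inhabited

Route `BiquadraticEisensteinDescent` (cell `pub/bsd-wall`, width-prover seat `bsd-wall-cm-bed-w1` g5, D-0152 M1). The V3 theorems
(`…ShapiroDatum`, p611673) and the lead's V4 are stated over an abstract coefficient ring `𝒪` (DVR, finite free over `ℤ_p`, basis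
`(1, b₁)` with `b₁² = d₀`, `b₁ ∈ 𝒪ˣ`, `ι : 𝒪 → 𝓞_{ℂ_p}` over `ℤ_p`). For `p` inert in `ℚ(√d₀)` (`d₀` a non-square unit mod `p`) this
file shows that Mathlib's `AdjoinRoot (X ^ 2 - C d)` has all these properties (`𝒪 = ℤ_{p²}`, the unramified quadratic extension):

* `irreducible_X_sq_sub_C`, `isDomain`, `exists_eq_of_add_of_mul_root` (`x = a + b√d`), `isUnit_of_not_dvd` (if `p ∤ (a, b)` then
  `a + b√d ∈ 𝒪ˣ`: its norm `a² − d b²` is a `p`-adic unit since `d` is a non-square mod `p`), `exists_eq_unit_mul_pow`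
  (`x = u·pⁿ`), `irreducible_p`, **`isDiscreteValuationRing`**;
* `free`, `finite`, `exists_basis` (`∃ b : Basis (Fin 2) ℤ_p 𝒪, b 0 = 1 ∧ b 1 = √d`), `isUnit_root`, `root_mul_root`;
* `exists_ringHom_padicComplexInt` (`∃ ι : 𝒪 →+* 𝓞_{ℂ_p}, ι ∘ algebraMap = R1.toCpInt p`: `ℂ_p` is algebraically closed and `|√d| ≤ 1`).

THEOREMS ONLY (no definition, no named fact, no instance, no `sorry`); nothing about the crux or BSD is asserted; BSD is not proved by
any of this. Supports stmt-BirchSwinnertonDyer-21341 as a helper. References: [SerreLocalFields1979] I §6–§8 (unramified extensions);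
[NeukirchANT1999] II (7.12); [Washington1997] §13.2 (`Λ_𝒪`).
-/

noncomputable section

open scoped Classical

open Polynomial

namespace Summit.BirchSwinnertonDyer.BirchSwinnertonDyer.Theorems.BiquadraticEisensteinDescentEisensteinHeartFlatCMInertBadKPrimeUnramifiedQuadraticRing

variable {p : ℕ} [Fact p.Prime]

/-- `X² − d` is monic. [folklore] -/
theorem monic_X_sq_sub_C (d : ℤ_[p]) : (X ^ 2 - C d : ℤ_[p][X]).Monic := monic_X_pow_sub_C d two_ne_zero

/-- `(√d)² = d` in `ℤ_p[X]/(X² − d)`. [folklore] -/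
theorem root_mul_root (d : ℤ_[p]) :
    AdjoinRoot.root (X ^ 2 - C d : ℤ_[p][X]) * AdjoinRoot.root (X ^ 2 - C d : ℤ_[p][X]) =
      algebraMap ℤ_[p] (AdjoinRoot (X ^ 2 - C d : ℤ_[p][X])) d := by
  have h := AdjoinRoot.eval₂_root (X ^ 2 - C d : ℤ_[p][X])
  rw [eval₂_sub, eval₂_X_pow, eval₂_C, sub_eq_zero] at h
  rw [← pow_two, h, AdjoinRoot.algebraMap_eq]

/-- Every element of `ℤ_p[X]/(X² − d)` is `a + b√d`. [folklore] -/
theorem exists_eq_of_add_of_mul_root (d : ℤ_[p]) (x : AdjoinRoot (X ^ 2 - C d : ℤ_[p][X])) :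
    ∃ a b : ℤ_[p], x = AdjoinRoot.of _ a + AdjoinRoot.of _ b * AdjoinRoot.root (X ^ 2 - C d : ℤ_[p][X]) := by
  induction x using AdjoinRoot.induction_on with
  | ih q =>
    set g : ℤ_[p][X] := X ^ 2 - C d with hg
    have hmonic : g.Monic := monic_X_sq_sub_C d
    have hdeg : (q %ₘ g).natDegree ≤ 1 := by
      have h2 : g.natDegree = 2 := by rw [hg]; exact natDegree_X_pow_sub_C
      have hne : g ≠ 1 := by
        intro h1; rw [h1, natDegree_one] at h2; exact absurd h2 (by decide)
      have := natDegree_modByMonic_lt q hmonic hne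
      omega
    refine ⟨(q %ₘ g).coeff 0, (q %ₘ g).coeff 1, ?_⟩
    have hq : AdjoinRoot.mk g q = AdjoinRoot.mk g (q %ₘ g) := by
      rw [AdjoinRoot.mk_eq_mk]
      refine ⟨q /ₘ g, ?_⟩
      have := modByMonic_add_div q g
      linear_combination -this
    rw [hq]
    conv_lhs => rw [eq_X_add_C_of_natDegree_le_one hdeg]
    rw [map_add, map_mul, AdjoinRoot.mk_C, AdjoinRoot.mk_C, AdjoinRoot.mk_X]
    ring

/-- If `d` is a non-square mod `p` (in particular a unit), then `d` is not a square in `ℤ_p`. [folklore] -/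
theorem not_exists_sq_eq (d : ℤ_[p]) (hd : ∀ y : ZMod p, y * y ≠ PadicInt.toZMod d) : ¬ ∃ y : ℤ_[p], y * y = d := by
  rintro ⟨y, hy⟩
  exact hd (PadicInt.toZMod y) (by rw [← map_mul, hy])

/-- `X² − d` is irreducible over `ℤ_p` when `d` is not a square mod `p` (a monic quadratic without roots over a domain).
[cite: NeukirchANT1999, II (7.12)] -/
theorem irreducible_X_sq_sub_C (d : ℤ_[p]) (hd : ∀ y : ZMod p, y * y ≠ PadicInt.toZMod d) :
    Irreducible (X ^ 2 - C d : ℤ_[p][X]) := by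
  have h2 : (X ^ 2 - C d : ℤ_[p][X]).natDegree = 2 := natDegree_X_pow_sub_C
  rw [(monic_X_sq_sub_C d).irreducible_iff_roots_eq_zero_of_degree_le_three (by omega) (by omega),
    Multiset.eq_zero_iff_forall_notMem]
  intro y hy
  rw [mem_roots (monic_X_sq_sub_C d).ne_zero, IsRoot, eval_sub, eval_pow, eval_X, eval_C, sub_eq_zero] at hy
  exact not_exists_sq_eq d hd ⟨y, by rw [← pow_two]; exact hy⟩

/-- `ℤ_p[X]/(X² − d)` is a domain for `d` a non-square mod `p`. [cite: NeukirchANT1999, II (7.12)] -/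
theorem isDomain (d : ℤ_[p]) (hd : ∀ y : ZMod p, y * y ≠ PadicInt.toZMod d) : IsDomain (AdjoinRoot (X ^ 2 - C d : ℤ_[p][X])) :=
  AdjoinRoot.isDomain_of_prime (UniqueFactorizationMonoid.irreducible_iff_prime.mp (irreducible_X_sq_sub_C d hd))

/-- `ℤ_p[X]/(X² − d)` is free over `ℤ_p`. [folklore] -/
theorem free (d : ℤ_[p]) : Module.Free ℤ_[p] (AdjoinRoot (X ^ 2 - C d : ℤ_[p][X])) := (monic_X_sq_sub_C d).free_adjoinRoot

/-- `ℤ_p[X]/(X² − d)` is finite over `ℤ_p`. [folklore] -/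
theorem finite (d : ℤ_[p]) : Module.Finite ℤ_[p] (AdjoinRoot (X ^ 2 - C d : ℤ_[p][X])) := (monic_X_sq_sub_C d).finite_adjoinRoot

/-- The basis `(1, √d)` of `ℤ_p[X]/(X² − d)` over `ℤ_p` (Mathlib's power basis, reindexed to `Fin 2`). [folklore] -/
theorem exists_basis (d : ℤ_[p]) :
    ∃ b : Module.Basis (Fin 2) ℤ_[p] (AdjoinRoot (X ^ 2 - C d : ℤ_[p][X])),
      b 0 = 1 ∧ b 1 = AdjoinRoot.root (X ^ 2 - C d : ℤ_[p][X]) := by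
  have h2 : (X ^ 2 - C d : ℤ_[p][X]).natDegree = 2 := natDegree_X_pow_sub_C
  let pb := AdjoinRoot.powerBasis' (monic_X_sq_sub_C d)
  refine ⟨pb.basis.reindex (finCongr h2), ?_, ?_⟩
  · rw [Module.Basis.reindex_apply, pb.basis_eq_pow]
    change AdjoinRoot.root _ ^ (((finCongr h2).symm 0 : Fin _) : ℕ) = 1
    simp
  · rw [Module.Basis.reindex_apply, pb.basis_eq_pow]
    change AdjoinRoot.root _ ^ (((finCongr h2).symm 1 : Fin _) : ℕ) = _
    simp

/-- `√d` is a unit of `ℤ_p[√d]` when `d ∈ ℤ_pˣ` (e.g. `d` a non-square mod `p`). [folklore] -/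
theorem isUnit_root (d : ℤ_[p]) (hd : IsUnit d) : IsUnit (AdjoinRoot.root (X ^ 2 - C d : ℤ_[p][X])) := by
  obtain ⟨u, hu⟩ := hd
  refine IsUnit.of_mul_eq_one (AdjoinRoot.root (X ^ 2 - C d : ℤ_[p][X]) * algebraMap ℤ_[p] _ (↑u⁻¹ : ℤ_[p])) ?_
  rw [← mul_assoc, root_mul_root, ← map_mul, ← hu, Units.mul_inv, map_one]

/-- `z ∈ ℤ_p` is a non-unit iff `p ∣ z`. [folklore] -/
theorem not_isUnit_iff_dvd (z : ℤ_[p]) : ¬ IsUnit z ↔ (p : ℤ_[p]) ∣ z := by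
  rw [← mem_nonunits_iff, ← IsLocalRing.mem_maximalIdeal, PadicInt.maximalIdeal_eq_span_p, Ideal.mem_span_singleton]

/-- A non-square mod `p` is a `p`-adic unit. [folklore] -/
theorem isUnit_of_nonsquare (d : ℤ_[p]) (hd : ∀ y : ZMod p, y * y ≠ PadicInt.toZMod d) : IsUnit d := by
  by_contra h
  have hmem := (Literature.NumberTheory.LocalFields.PadicInt.dvd_iff_toZMod_eq_zero d).mp ((not_isUnit_iff_dvd d).mp h)
  exact hd 0 (by rw [zero_mul, hmem])

/-- **Units away from `p`.** If not both `a, b` are divisible by `p` then `a + b√d` is a unit of `ℤ_p[√d]`: its norm `a² − d b²` is a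
`p`-adic unit because `d` is a non-square mod `p`. [cite: SerreLocalFields1979, I §6] -/
theorem isUnit_of_not_dvd (d : ℤ_[p]) (hd : ∀ y : ZMod p, y * y ≠ PadicInt.toZMod d) (a b : ℤ_[p])
    (hab : ¬ ((p : ℤ_[p]) ∣ a ∧ (p : ℤ_[p]) ∣ b)) :
    IsUnit (AdjoinRoot.of _ a + AdjoinRoot.of _ b * AdjoinRoot.root (X ^ 2 - C d : ℤ_[p][X])) := by
  -- the norm is a unit of `ℤ_p`
  have hN : IsUnit (a * a - d * (b * b)) := by
    by_contra hN
    have hmem := (Literature.NumberTheory.LocalFields.PadicInt.dvd_iff_toZMod_eq_zero _).mp ((not_isUnit_iff_dvd _).mp hN)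
    rw [map_sub, map_mul, map_mul, map_mul, sub_eq_zero] at hmem
    have hdvd : ∀ z : ℤ_[p], PadicInt.toZMod z = 0 → (p : ℤ_[p]) ∣ z := fun z hz ↦ (Literature.NumberTheory.LocalFields.PadicInt.dvd_iff_toZMod_eq_zero z).mpr hz
    by_cases hb : PadicInt.toZMod b = 0
    · rw [hb, mul_zero, mul_zero, mul_self_eq_zero] at hmem
      exact hab ⟨hdvd a hmem, hdvd b hb⟩
    · have hb2 : PadicInt.toZMod b * PadicInt.toZMod b ≠ 0 := mul_ne_zero hb hb
      apply hd (PadicInt.toZMod a * (PadicInt.toZMod b)⁻¹)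
      rw [show PadicInt.toZMod a * (PadicInt.toZMod b)⁻¹ * (PadicInt.toZMod a * (PadicInt.toZMod b)⁻¹) =
        PadicInt.toZMod a * PadicInt.toZMod a * (PadicInt.toZMod b * PadicInt.toZMod b)⁻¹ by rw [mul_inv]; ring,
        hmem, mul_inv_cancel_right₀ hb2]
  obtain ⟨n, hn⟩ := hN
  refine IsUnit.of_mul_eq_one ((AdjoinRoot.of _ a - AdjoinRoot.of _ b * AdjoinRoot.root (X ^ 2 - C d : ℤ_[p][X])) *
    AdjoinRoot.of _ (↑n⁻¹ : ℤ_[p])) ?_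
  have key : (AdjoinRoot.of _ a + AdjoinRoot.of _ b * AdjoinRoot.root (X ^ 2 - C d : ℤ_[p][X])) *
      (AdjoinRoot.of _ a - AdjoinRoot.of _ b * AdjoinRoot.root (X ^ 2 - C d : ℤ_[p][X])) =
      AdjoinRoot.of _ (a * a - d * (b * b)) := by
    have hr := root_mul_root (p := p) d
    rw [AdjoinRoot.algebraMap_eq] at hr
    rw [map_sub, map_mul, map_mul, map_mul, ← hr]
    ring
  rw [← mul_assoc, key, ← map_mul, ← hn, Units.mul_inv, map_one]

/-- `p` is not a unit of `ℤ_p[√d]` (it kills `𝒪/p𝒪 ≅ 𝔽_{p²} ≠ 0`; here: coordinates in the basis `(1, √d)`). [folklore] -/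
theorem not_isUnit_p (d : ℤ_[p]) : ¬ IsUnit ((p : ℤ_[p]) • (1 : AdjoinRoot (X ^ 2 - C d : ℤ_[p][X]))) := by
  intro hu
  obtain ⟨b, hb0, -⟩ := exists_basis (p := p) d
  obtain ⟨v, hv⟩ := hu.exists_right_inv
  -- apply the first coordinate: `p * (coord v) = 1` in `ℤ_p`
  have h1 : b.repr (((p : ℤ_[p]) • (1 : AdjoinRoot (X ^ 2 - C d : ℤ_[p][X]))) * v) 0 = 1 := by
    rw [hv, ← hb0, b.repr_self, Finsupp.single_eq_same]
  rw [smul_mul_assoc, one_mul, map_smul, Finsupp.smul_apply, smul_eq_mul] at h1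
  have hp : IsUnit (p : ℤ_[p]) := IsUnit.of_mul_eq_one _ h1
  exact PadicInt.irreducible_p.not_isUnit hp

/-- Valuation bookkeeping in `ℤ_p`: `v(p·a) = v(a) + 1` for `a ≠ 0`. [folklore] -/
theorem valuation_p_mul {a : ℤ_[p]} (ha : a ≠ 0) : ((p : ℤ_[p]) * a).valuation = a.valuation + 1 := by
  have := PadicInt.valuation_p_pow_mul 1 a ha
  rw [pow_one] at this
  omega

/-- **Every non-zero element of `ℤ_p[√d]` is a unit times a power of `p`** (`d` a non-square mod `p`): if `p` divides both coordinates
divide by `p` (the sum of the coordinate valuations drops), otherwise `isUnit_of_not_dvd`. [cite: SerreLocalFields1979, I §6] -/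
theorem exists_eq_unit_mul_pow (d : ℤ_[p]) (hd : ∀ y : ZMod p, y * y ≠ PadicInt.toZMod d) :
    ∀ (m : ℕ) (a b : ℤ_[p]), (a ≠ 0 ∨ b ≠ 0) → a.valuation + b.valuation ≤ m →
      ∃ (n : ℕ) (u : (AdjoinRoot (X ^ 2 - C d : ℤ_[p][X]))ˣ),
        AdjoinRoot.of _ a + AdjoinRoot.of _ b * AdjoinRoot.root (X ^ 2 - C d : ℤ_[p][X]) =
          (u : AdjoinRoot (X ^ 2 - C d : ℤ_[p][X])) * (AdjoinRoot.of _ (p : ℤ_[p])) ^ n := by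
  intro m
  induction m with
  | zero =>
    intro a b hab hμ
    by_cases hdiv : (p : ℤ_[p]) ∣ a ∧ (p : ℤ_[p]) ∣ b
    · -- both divisible by `p` forces a positive valuation unless zero
      exfalso
      obtain ⟨⟨a', rfl⟩, ⟨b', rfl⟩⟩ := hdiv
      rcases hab with ha | hb
      · have ha' : a' ≠ 0 := by rintro rfl; exact ha (mul_zero _)
        have := valuation_p_mul ha'
        omega
      · have hb' : b' ≠ 0 := by rintro rfl; exact hb (mul_zero _)
        have := valuation_p_mul hb'
        omega
    · obtain ⟨u, hu⟩ := isUnit_of_not_dvd d hd a b hdiv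
      exact ⟨0, u, by rw [hu, pow_zero, mul_one]⟩
  | succ m ih =>
    intro a b hab hμ
    by_cases hdiv : (p : ℤ_[p]) ∣ a ∧ (p : ℤ_[p]) ∣ b
    · obtain ⟨⟨a', rfl⟩, ⟨b', rfl⟩⟩ := hdiv
      have hab' : a' ≠ 0 ∨ b' ≠ 0 := by
        rcases hab with ha | hb
        · exact Or.inl (by rintro rfl; exact ha (mul_zero _))
        · exact Or.inr (by rintro rfl; exact hb (mul_zero _))
      have hμ' : a'.valuation + b'.valuation ≤ m := by
        rcases hab' with ha' | hb'
        · have h1 := valuation_p_mul ha'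
          by_cases hb0 : b' = 0
          · subst hb0; rw [mul_zero] at hμ; simp only [PadicInt.valuation_zero, add_zero] at hμ ⊢; omega
          · have h2 := valuation_p_mul hb0; omega
        · have h2 := valuation_p_mul hb'
          by_cases ha0 : a' = 0
          · subst ha0; rw [mul_zero] at hμ; simp only [PadicInt.valuation_zero, zero_add] at hμ ⊢; omega
          · have h1 := valuation_p_mul ha0; omega
      obtain ⟨n, u, hu⟩ := ih a' b' hab' hμ'
      refine ⟨n + 1, u, ?_⟩
      rw [map_mul, map_mul, pow_succ (AdjoinRoot.of (X ^ 2 - C d : ℤ_[p][X]) (p : ℤ_[p])) n, ← mul_assoc, ← hu]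
      ring
    · obtain ⟨u, hu⟩ := isUnit_of_not_dvd d hd a b hdiv
      exact ⟨0, u, by rw [hu, pow_zero, mul_one]⟩

/-- `p` is irreducible in `ℤ_p[√d]` (`d` a non-square mod `p`): not a unit, and a factorisation `p = x y` into `u pᵐ · v pᵏ` forces
`m + k = 1`. [cite: SerreLocalFields1979, I §6] -/
theorem irreducible_p (d : ℤ_[p]) (hd : ∀ y : ZMod p, y * y ≠ PadicInt.toZMod d) :
    Irreducible (AdjoinRoot.of (X ^ 2 - C d : ℤ_[p][X]) (p : ℤ_[p])) := by
  haveI := isDomain d hd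
  have hpu : ¬ IsUnit (AdjoinRoot.of (X ^ 2 - C d : ℤ_[p][X]) (p : ℤ_[p])) := by
    have h := not_isUnit_p (p := p) d
    rwa [Algebra.smul_def, mul_one, AdjoinRoot.algebraMap_eq] at h
  have hp0 : AdjoinRoot.of (X ^ 2 - C d : ℤ_[p][X]) (p : ℤ_[p]) ≠ 0 := by
    intro h0
    apply hpu
    -- impossible: `0` would then divide `p ≠ 0`; use injectivity of `of`
    exact absurd h0 ((map_ne_zero_iff _ (AdjoinRoot.of.injective_of_degree_ne_zero (by
      rw [degree_X_pow_sub_C (by norm_num) d]; decide))).mpr (by exact_mod_cast (Fact.out : p.Prime).ne_zero))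
  refine ⟨hpu, fun x y hxy ↦ ?_⟩
  have hx0 : x ≠ 0 := by rintro rfl; exact hp0 (by rw [hxy, zero_mul])
  have hy0 : y ≠ 0 := by rintro rfl; exact hp0 (by rw [hxy, mul_zero])
  obtain ⟨a, b, rfl⟩ := exists_eq_of_add_of_mul_root d x
  obtain ⟨a', b', rfl⟩ := exists_eq_of_add_of_mul_root d y
  have hab : a ≠ 0 ∨ b ≠ 0 := by
    by_contra h; push Not at h; obtain ⟨rfl, rfl⟩ := h; exact hx0 (by simp)
  have hab' : a' ≠ 0 ∨ b' ≠ 0 := by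
    by_contra h; push Not at h; obtain ⟨rfl, rfl⟩ := h; exact hy0 (by simp)
  obtain ⟨m, u, hu⟩ := exists_eq_unit_mul_pow d hd _ a b hab le_rfl
  obtain ⟨k, v, hv⟩ := exists_eq_unit_mul_pow d hd _ a' b' hab' le_rfl
  rw [hu, hv] at hxy ⊢
  set P := AdjoinRoot.of (X ^ 2 - C d : ℤ_[p][X]) (p : ℤ_[p]) with hP
  -- `P = (u v) P^(m+k)`
  have hxy' : P = ((u * v : (AdjoinRoot (X ^ 2 - C d : ℤ_[p][X]))ˣ) : AdjoinRoot (X ^ 2 - C d : ℤ_[p][X])) * P ^ (m + k) := by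
    rw [Units.val_mul, pow_add]
    conv_lhs => rw [hxy]
    ring
  rcases Nat.eq_zero_or_pos (m + k) with h0 | hpos
  · -- `m = k = 0`: `P = u v` would be a unit
    exfalso
    rw [h0, pow_zero, mul_one] at hxy'
    exact hpu (hxy' ▸ (u * v).isUnit)
  · have hmk : P * 1 = P * (((u * v : (AdjoinRoot (X ^ 2 - C d : ℤ_[p][X]))ˣ) : AdjoinRoot (X ^ 2 - C d : ℤ_[p][X])) *
        P ^ (m + k - 1)) := by
      conv_lhs => rw [mul_one, hxy', show m + k = (m + k - 1) + 1 by omega, pow_succ P (m + k - 1)]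
      ring
    have hcancel := mul_left_cancel₀ hp0 hmk
    -- so `P^(m+k-1)` is a unit, hence `m + k - 1 = 0`
    have hunit : IsUnit (P ^ (m + k - 1)) := isUnit_of_mul_isUnit_right (hcancel ▸ isUnit_one)
    have hmk1 : m + k - 1 = 0 := by
      by_contra hne
      exact hpu ((isUnit_pow_iff hne).mp hunit)
    rcases Nat.eq_zero_or_pos m with hm | hm
    · left; rw [hm, pow_zero, mul_one]; exact u.isUnit
    · right
      have hk : k = 0 := by omega
      rw [hk, pow_zero, mul_one]; exact v.isUnit

/-- **`ℤ_p[√d] = ℤ_p[X]/(X² − d)` is a discrete valuation ring** for `d` a non-square unit mod `p` (the unramified quadratic extension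
`ℤ_{p²}`), via Mathlib's `ofHasUnitMulPowIrreducibleFactorization` with uniformiser `p`. [cite: SerreLocalFields1979, I §6–§8] -/
theorem isDiscreteValuationRing (d : ℤ_[p]) (hd : ∀ y : ZMod p, y * y ≠ PadicInt.toZMod d) :
    @IsDiscreteValuationRing (AdjoinRoot (X ^ 2 - C d : ℤ_[p][X])) _ (isDomain d hd) := by
  haveI := isDomain d hd
  refine IsDiscreteValuationRing.ofHasUnitMulPowIrreducibleFactorization ⟨_, irreducible_p d hd, fun {x} hx ↦ ?_⟩
  obtain ⟨a, b, rfl⟩ := exists_eq_of_add_of_mul_root d x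
  have hab : a ≠ 0 ∨ b ≠ 0 := by
    by_contra h; push Not at h; obtain ⟨rfl, rfl⟩ := h; exact hx (by simp)
  obtain ⟨n, u, hu⟩ := exists_eq_unit_mul_pow d hd _ a b hab le_rfl
  exact ⟨n, ⟨u, by rw [hu, mul_comm]⟩⟩

/-- **An embedding `ℤ_p[√d] → 𝓞_{ℂ_p}` over `ℤ_p`**: `ℂ_p` is algebraically closed, so `d` has a square root `r`, and `|r|² = |d| ≤ 1`.
[cite: NeukirchANT1999, II (7.12)] -/
theorem exists_ringHom_padicComplexInt (d : ℤ_[p]) :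
    ∃ ι : AdjoinRoot (X ^ 2 - C d : ℤ_[p][X]) →+* 𝓞_ℂ_[p],
      ι.comp (algebraMap ℤ_[p] (AdjoinRoot (X ^ 2 - C d : ℤ_[p][X]))) =
        Summit.BirchSwinnertonDyer.Rank1Residual.X11b.R1.toCpInt p := by
  set dC : ℂ_[p] := ((Summit.BirchSwinnertonDyer.Rank1Residual.X11b.R1.toCpInt p d : 𝓞_ℂ_[p]) : ℂ_[p]) with hdC
  obtain ⟨r, hr⟩ := IsAlgClosed.exists_pow_nat_eq dC two_pos
  have hr1 : ‖r‖ ≤ 1 := by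
    have h : ‖r‖ ^ 2 = ‖dC‖ := by rw [← norm_pow, hr]
    have hd1 : ‖dC‖ ≤ 1 :=
      Literature.NumberTheory.LFunctions.Dwork.mem_unitBall.mp (Summit.BirchSwinnertonDyer.Rank1Residual.X11b.R1.toCpInt p d).2
    nlinarith [norm_nonneg r]
  let rI : 𝓞_ℂ_[p] := ⟨r, Literature.NumberTheory.LFunctions.Dwork.mem_unitBall.mpr hr1⟩
  have hroot : (X ^ 2 - C d : ℤ_[p][X]).eval₂ (Summit.BirchSwinnertonDyer.Rank1Residual.X11b.R1.toCpInt p) rI = 0 := by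
    rw [eval₂_sub, eval₂_X_pow, eval₂_C, sub_eq_zero]
    apply Subtype.ext
    change r ^ 2 = dC
    exact hr
  refine ⟨AdjoinRoot.lift _ rI hroot, ?_⟩
  ext a
  rw [RingHom.comp_apply, AdjoinRoot.algebraMap_eq, AdjoinRoot.lift_of]

end Summit.BirchSwinnertonDyer.BirchSwinnertonDyer.Theorems.BiquadraticEisensteinDescentEisensteinHeartFlatCMInertBadKPrimeUnramifiedQuadraticRing

end
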